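import Mathlib
import Literature.AlgebraicGeometry.Resolution.CutkoskySurfaceOmegaCurveChart
import Literature.AlgebraicGeometry.Resolution.PointBlowupPolygonLaws
import HarnessLib

/-!
# Cutkosky 2009, Lemma 10.11 (1) / 10.14: `Ω` under the point blow-up at the origin of the `x`-chart

Topic: `Literature/AlgebraicGeometry/Resolution`.  S. D. Cutkosky, Amer. J. Math. **131** (2009)
[cite: Cutkosky2009], §10.4: under **Tr1 with `η = 0`** (`Sing_r(I) = V(x, y, z)`; `x = x₁`,
`y = x₁ y₁`, `z = x₁ z₁`; `I₁ = (1/x₁^r) I T₁`, Def. 10.10 p. 31) the characteristic polygon moves by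
"`σ(a, b) = (a + b − 1, b)`" (Lemma 10.11 (1), p. 32 l. 11); "`σ` transforms lines of slope `m ≠ −1`
to lines of slope `m/(m+1)`, and transforms lines of slope `−1` to vertical lines" (proof of Lemma
10.14, p. 33 l. 60–64), whence Lemma 10.14 (p. 33 l. 46–58): "`(β₁, 1/ε₁, α₁) < (β, 1/ε, α)` in the
lexicographical order. If `β₁ = β`, and `ε ≠ 0`, then `1/ε₁ = 1/ε − 1`", with the remark "We need the
assumption `Sing_r(I) = V(x, y, z)` so that `β < 1`, to conclude that `α₁ < α` if `ε = 0`" (l. 66–68)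
and p. 28 observation 4 "A vertex of `|Δ|` lies below the line `b = 1` if and only if `I ⊄ (y, z)^r`".

This file PROVES these polygon statements for `Ω` computed in the CHART parameters
`(x₁, y₁, z₁)` themselves, in the expansion-free abstract POINT CHART of the tree
(`PointBlowupPolygonLaws.lean` = CJS LNM 2270 Lemma 12.1 (3): `φ : R → R′` regular local rings of
dimension `3`, `c = (y, u₁, u₂) ↔ (z, x, y)`, `c′₁ = φ u₁`, `φ y = φ u₁ · y′`, `φ u₂ = φ u₁ · u′₂`,
`J′ = (J R′ : (φ u₁)^μ)`, hypotheses `J ⊆ 𝔪^μ`, `δ > 1` scaled `L < deltaS`; the tree gives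
`α′ = δ − 1`, `β′ = γ⁻ ≤ β`, CJS `ε′ = ε` there):

* `deltaS_eq_of_betaS_colon_eq`: if `β′ = β` then `δ = α + β` (the vertex `v` lies on the `δ`-face
  and is its lowest point), so `α′ = α + β − 1`;
* `slopeOf_colon_point_le` / `le_epsCu_colon_point`: if `β′ = β` and `ε = d/n > 0` is realised at a
  Newton point, then Cutkosky's slope after the chart is EXACTLY `d/(n − d)` (`n > d`), i.e.
  **`1/ε′ = 1/ε − 1`** (`invEpsCu_colon_point_add_one`) — both inequalities by the tree's two-sided
  half-plane transport (`forall_pts_colon_of_forall_pts`, `chartPt_mem_pts`);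
* `epsCu_colon_point_eq_zero`: if `β′ = β` and `ε = 0` then `ε′ = 0`;
* `OmegaCu_colon_point_lt`: **`Ω′ < Ω`** provided some Newton point lies below the line `b = 1`
  (`∃ e ∈ pts, spt₂ e < L`, i.e. "`I ⊄ (y, z)^r`", automatic when `Sing_r(I)` is the closed point),
  and the step law `cuStep_colon_point`.

SCOPE (honest): Lemma 10.14 itself computes `Ω₁` in a VERY WELL PREPARATION `(x₁, y′, z′)` of the
chart parameters and assumes `(I; x, y, z)` very well prepared; those parameter changes at the new
point (Def. 10.8, Lemma 10.7) are NOT formalised here — the theorems below are the `σ`-computation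
on which that proof rests ("We deduce the formulas for transformation of `α, β, γ, δ, ε` from
consideration of the effect of a Tr1 transformation followed by very well preparation", l. 65–66),
for the chart parameters, in CJS generality (any regular local ring of dimension `3`).  The companion
`CutkoskySurfaceOmegaCurveChart.lean` treats Tr3.  AI-written proofs; weaker than expert review.
No named facts.

## Sources

* S. D. Cutkosky, Amer. J. Math. 131 (2009), §10.1 obs. 4 p. 28 l. 63; Def. 10.10; Lemma 10.11 (1)
  p. 32 l. 11; Lemma 10.14 and its proof p. 33 l. 46–72. [Cutkosky2009]
* V. Cossart, U. Jannsen, S. Saito, LNM 2270 (2020), Lemma 12.1 (3). [CossartJannsenSaito2020]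
-/

noncomputable section

open IsLocalRing

namespace Literature.AlgebraicGeometry.Resolution.Cutkosky2009

universe u

section PointChart

variable {R R' : Type u} [CommRing R] [CommRing R'] (φ : R →+* R') {c : Fin 3 → R}
  {c' : Fin 3 → R'} (h₁ : c' 1 = φ (c 1)) (h₀ : φ (c 0) = φ (c 1) * c' 0)
  (h₂ : φ (c 2) = φ (c 1) * c' 2)
  [IsRegularLocalRing R] [IsRegularLocalRing R']
  (hgen : Ideal.span {c 0, c 1, c 2} = maximalIdeal R) (hdim : ringKrullDim R = 3)
  (hgen' : Ideal.span {c' 0, c' 1, c' 2} = maximalIdeal R') (hdim' : ringKrullDim R' = 3)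
  {J : Ideal R} {μ : ℕ}

include h₁ h₀ h₂ hgen hdim hgen' hdim' in
/-- If `β′ = β` at the origin of the chart then the vertex `v = (α, β)` is the lowest point of the
`δ`-face: `δ = α + β` (scaled). [cite: Cutkosky2009, Lemma 10.14 proof p. 33 l. 60–68] -/
theorem deltaS_eq_of_betaS_colon_eq (hJμ : J ≤ maximalIdeal R ^ μ) (hne : (pts c J μ).Nonempty)
    (hδ : μ.factorial < deltaS c J μ)
    (hβ : betaS c' ((J.map φ).colon {φ (c 1) ^ μ}) μ = betaS c J μ) :
    deltaS c J μ = alphaS c J μ + betaS c J μ := by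
  have hγ : gammaMinusS c J μ = betaS c J μ := by
    rw [← hβ, betaS_colon_eq φ h₁ h₀ h₂ hgen hdim hgen' hdim' hJμ hne hδ]
  obtain ⟨w, hw, hsum, h2⟩ := exists_pts_wMinus hne
  have hαw := alphaS_le hw
  have := deltaS_le_alphaS_add_betaS hne
  omega

include h₁ h₀ h₂ hgen hdim hgen' hdim' in
/-- If `β′ = β` then `α′ = α + β − 1` (scaled: `αs′ + L = αs + βs`): the image `σ(v)` is the new
vertex. [cite: Cutkosky2009, Lemma 10.11 (1) p. 32 l. 11] -/
theorem alphaS_colon_add_of_betaS_colon_eq (hJμ : J ≤ maximalIdeal R ^ μ)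
    (hne : (pts c J μ).Nonempty) (hδ : μ.factorial < deltaS c J μ)
    (hβ : betaS c' ((J.map φ).colon {φ (c 1) ^ μ}) μ = betaS c J μ) :
    alphaS c' ((J.map φ).colon {φ (c 1) ^ μ}) μ + μ.factorial = alphaS c J μ + betaS c J μ := by
  rw [alphaS_colon_add φ h₁ h₀ h₂ hgen hdim hgen' hdim' hJμ hne hδ,
    deltaS_eq_of_betaS_colon_eq φ h₁ h₀ h₂ hgen hdim hgen' hdim' hJμ hne hδ hβ]

omit [IsRegularLocalRing R] in
/-- When `δ = α + β` and `γ⁻ = β`, a Newton point `e` below the level `β` has run exceeding its drop: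
`a − α > β − b` (it lies strictly above the `δ`-line). [cite: Cutkosky2009, Lemma 10.14 proof p. 33 l. 60–64] -/
theorem drop_lt_run (hδαβ : deltaS c J μ = alphaS c J μ + betaS c J μ)
    (hγ : gammaMinusS c J μ = betaS c J μ) {e : Fin 3 →₀ ℕ} (he : e ∈ lowPts c J μ) :
    betaS c J μ - spt₂ μ e < spt₁ μ e - alphaS c J μ := by
  have h1 := alphaS_lt_spt₁_of_mem_lowPts he
  have h2 := he.2
  have hδe := deltaS_le he.1
  rcases hδe.eq_or_lt with heq | hlt
  · have := gammaMinusS_le he.1 heq.symm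
    omega
  · omega

include h₁ h₀ h₂ hgen hdim hgen' hdim' in
/-- **Upper bound after the chart** (`β′ = β`, `ε = d/n > 0` realised at `e`): every slope from the
new vertex `v′ = (α + β − 1, β)` is `≤ d/(n − d)` — the image of the `ε`-line ("lines of slope `m`
go to lines of slope `m/(m+1)`") descends to `J′`. [cite: Cutkosky2009, Lemma 10.14 proof p. 33 l. 60–64] -/
theorem slopeOf_colon_point_le (hJμ : J ≤ maximalIdeal R ^ μ) (hne : (pts c J μ).Nonempty)
    (hδ : μ.factorial < deltaS c J μ)
    (hβ : betaS c' ((J.map φ).colon {φ (c 1) ^ μ}) μ = betaS c J μ)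
    {e : Fin 3 →₀ ℕ} (he : e ∈ lowPts c J μ) (heq : slopeOf c J μ e = epsCu c J μ)
    {e' : Fin 3 →₀ ℕ} (he' : e' ∈ lowPts c' ((J.map φ).colon {φ (c 1) ^ μ}) μ) :
    slopeOf c' ((J.map φ).colon {φ (c 1) ^ μ}) μ e' ≤
      ((betaS c J μ - spt₂ μ e : ℕ) : ℚ) / ((spt₁ μ e - alphaS c J μ : ℕ) - (betaS c J μ - spt₂ μ e : ℕ) : ℕ) := by
  have hδαβ := deltaS_eq_of_betaS_colon_eq φ h₁ h₀ h₂ hgen hdim hgen' hdim' hJμ hne hδ hβ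
  have hγ : gammaMinusS c J μ = betaS c J μ := by
    rw [← hβ, betaS_colon_eq φ h₁ h₀ h₂ hgen hdim hgen' hdim' hJμ hne hδ]
  have hα' := alphaS_colon_add_of_betaS_colon_eq φ h₁ h₀ h₂ hgen hdim hgen' hdim' hJμ hne hδ hβ
  have h1 := alphaS_lt_spt₁_of_mem_lowPts he
  have h2 := he.2
  have hdn := drop_lt_run hδαβ hγ he
  set d := betaS c J μ - spt₂ μ e with hd
  set n := spt₁ μ e - alphaS c J μ with hn
  have hdpos : 0 < d := by omega
  have hnd : 0 < n - d := by omega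
  -- the level form `d x₁ + n x₂ ≥ d α + n β` on `pts`, read as a pull-back with `p₂′ = n − d`
  have hw₀le : μ.factorial * d ≤ d * alphaS c J μ + n * betaS c J μ := by
    have : d * (alphaS c J μ + betaS c J μ) ≥ d * (μ.factorial + 1) :=
      Nat.mul_le_mul_left _ (by omega)
    nlinarith
  set w₀' := d * alphaS c J μ + n * betaS c J μ - μ.factorial * d with hw₀'
  have hw₀pos : 0 < w₀' := by
    have hβpos : 0 < betaS c J μ := by omega
    have i1 : d * (μ.factorial + 1) ≤ d * (alphaS c J μ + betaS c J μ) :=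
      Nat.mul_le_mul_left _ (by omega)
    have i2 : (d + 1) * betaS c J μ ≤ n * betaS c J μ := Nat.mul_le_mul_right _ (by omega)
    have e1 : d * (alphaS c J μ + betaS c J μ) = d * alphaS c J μ + d * betaS c J μ := by ring
    have e2 : d * (μ.factorial + 1) = μ.factorial * d + d := by ring
    have e3 : (d + 1) * betaS c J μ = d * betaS c J μ + betaS c J μ := by ring
    omega
  have hS : ∀ x ∈ pts c J μ, w₀' + μ.factorial * d ≤ d * spt₁ μ x + (d + (n - d)) * spt₂ μ x := by
    intro x hx
    have := levelForm_le_of_slopeOf_eq_epsCu he heq hx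
    have hnd' : d + (n - d) = n := by omega
    rw [hnd', hw₀', Nat.sub_add_cancel hw₀le, hd, hn]
    linarith [this]
  have hT := forall_pts_colon_of_forall_pts φ h₁ h₀ h₂ hgen hdim hgen' hdim' hw₀pos hdpos hnd hS
    e' he'.1
  -- `w₀′ = d α′ + (n − d) β′` with `α′ = α + β − L`, `β′ = β`
  have h1' := alphaS_lt_spt₁_of_mem_lowPts he'
  have hw₀eq : w₀' + μ.factorial * d = d * alphaS c J μ + n * betaS c J μ := Nat.sub_add_cancel hw₀le
  have hineq : ((n - d : ℕ) : ℚ) * ((betaS c' ((J.map φ).colon {φ (c 1) ^ μ}) μ : ℚ) - spt₂ μ e') ≤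
      (d : ℚ) * ((spt₁ μ e' : ℚ) - alphaS c' ((J.map φ).colon {φ (c 1) ^ μ}) μ) := by
    have hT' : ((w₀' : ℕ) : ℚ) ≤ ((d * spt₁ μ e' + (n - d) * spt₂ μ e' : ℕ) : ℚ) := by exact_mod_cast hT
    have hw₀Q : ((w₀' : ℕ) : ℚ) + (μ.factorial : ℚ) * d = d * alphaS c J μ + n * betaS c J μ := by
      exact_mod_cast hw₀eq
    have hαQ : (alphaS c' ((J.map φ).colon {φ (c 1) ^ μ}) μ : ℚ) + μ.factorial =
        alphaS c J μ + betaS c J μ := by exact_mod_cast hα'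
    have hndQ : ((n - d : ℕ) : ℚ) = (n : ℚ) - d := by rw [Nat.cast_sub hdn.le]
    rw [hβ, hndQ]
    push_cast at hT'
    rw [hndQ] at hT'
    nlinarith [hT', hw₀Q, hαQ]
  have hnQ : (0 : ℚ) < (spt₁ μ e' : ℚ) - alphaS c' ((J.map φ).colon {φ (c 1) ^ μ}) μ := by
    have : (alphaS c' ((J.map φ).colon {φ (c 1) ^ μ}) μ : ℚ) < spt₁ μ e' := by exact_mod_cast h1'
    linarith
  unfold slopeOf
  rw [div_le_div_iff₀ hnQ (by exact_mod_cast hnd)]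
  linarith [hineq]

include h₁ h₀ h₂ hgen hdim hgen' hdim' in
/-- **Lower bound after the chart** (`β′ = β`, `ε = d/n > 0` realised at `e`): the image `σ(e)`
is a Newton point of the weak transform below the level `β′`, with slope `d/(n − d)` from `v′`.
[cite: Cutkosky2009, Lemma 10.11 (1) p. 32 l. 11] -/
theorem le_epsCu_colon_point (hJμ : J ≤ maximalIdeal R ^ μ) (hne : (pts c J μ).Nonempty)
    (hδ : μ.factorial < deltaS c J μ)
    (hβ : betaS c' ((J.map φ).colon {φ (c 1) ^ μ}) μ = betaS c J μ)
    {e : Fin 3 →₀ ℕ} (he : e ∈ lowPts c J μ) (heq : slopeOf c J μ e = epsCu c J μ) :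
    ((betaS c J μ - spt₂ μ e : ℕ) : ℚ) / ((spt₁ μ e - alphaS c J μ : ℕ) - (betaS c J μ - spt₂ μ e : ℕ) : ℕ)
      ≤ epsCu c' ((J.map φ).colon {φ (c 1) ^ μ}) μ := by
  have hδαβ := deltaS_eq_of_betaS_colon_eq φ h₁ h₀ h₂ hgen hdim hgen' hdim' hJμ hne hδ hβ
  have hγ : gammaMinusS c J μ = betaS c J μ := by
    rw [← hβ, betaS_colon_eq φ h₁ h₀ h₂ hgen hdim hgen' hdim' hJμ hne hδ]
  have hα' := alphaS_colon_add_of_betaS_colon_eq φ h₁ h₀ h₂ hgen hdim hgen' hdim' hJμ hne hδ hβ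
  have h1 := alphaS_lt_spt₁_of_mem_lowPts he
  have h2 := he.2
  have hdn := drop_lt_run hδαβ hγ he
  set d := betaS c J μ - spt₂ μ e with hd
  set n := spt₁ μ e - alphaS c J μ with hn
  have hdpos : 0 < d := by omega
  have hnd : 0 < n - d := by omega
  -- `e` minimises `d spt₁ + n spt₂`
  have hval : d * spt₁ μ e + n * spt₂ μ e = d * alphaS c J μ + n * betaS c J μ := by
    rw [hd, hn]; zify [h1.le, h2.le]; ring
  have hmin : ∀ x ∈ pts c J μ, d * spt₁ μ e + (d + (n - d)) * spt₂ μ e ≤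
      d * spt₁ μ x + (d + (n - d)) * spt₂ μ x := by
    intro x hx
    have := levelForm_le_of_slopeOf_eq_epsCu he heq hx
    have hnd' : d + (n - d) = n := by omega
    rw [hnd', hval, hd, hn]; linarith [this]
  have hnd' : d + (n - d) = n := by omega
  have hpos : 0 < d * spt₁ μ e + (d + (n - d)) * spt₂ μ e := by
    rw [hnd', hval]
    exact Nat.add_pos_right _ (Nat.mul_pos (by omega) (by omega))
  obtain ⟨f, hf, hinit⟩ :=
    exists_isInitialTerm_levelWeight_of_isMinOn c hgen hdim hdpos (by omega) he.1 hmin hpos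
  have hw₀le : μ.factorial * d ≤ d * spt₁ μ e + (d + (n - d)) * spt₂ μ e := by
    rw [hnd', hval]
    have : d * (alphaS c J μ + betaS c J μ) ≥ d * (μ.factorial + 1) :=
      Nat.mul_le_mul_left _ (by omega)
    nlinarith
  set w₀' := d * spt₁ μ e + (d + (n - d)) * spt₂ μ e - μ.factorial * d with hw₀'
  have hw₀pos : 0 < w₀' := by
    have hβpos : 0 < betaS c J μ := by omega
    have i1 : d * (μ.factorial + 1) ≤ d * (alphaS c J μ + betaS c J μ) :=
      Nat.mul_le_mul_left _ (by omega)
    have i2 : (d + 1) * betaS c J μ ≤ n * betaS c J μ := Nat.mul_le_mul_right _ (by omega)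
    have e1 : d * (alphaS c J μ + betaS c J μ) = d * alphaS c J μ + d * betaS c J μ := by ring
    have e2 : d * (μ.factorial + 1) = μ.factorial * d + d := by ring
    have e3 : (d + 1) * betaS c J μ = d * betaS c J μ + betaS c J μ := by ring
    rw [hw₀', hnd', hval]
    omega
  have hwt : levelWeight μ (d * spt₁ μ e + (d + (n - d)) * spt₂ μ e) d (d + (n - d)) =
      pullbackWeight (levelWeight μ w₀' d (n - d)) := by
    rw [← levelWeight_eq_pullbackWeight, Nat.sub_add_cancel hw₀le]
  rw [hwt] at hinit
  have hW' : ∀ i, 0 < levelWeight μ w₀' d (n - d) i := levelWeight_pos hw₀pos hdpos hnd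
  have hmem := chartPt_mem_pts φ h₁ h₀ h₂ _ hgen hdim hgen' hdim' hW' hJμ hf he.1.2 hinit
  have hdeg : μ ≤ e 0 + e 1 + e 2 := by
    have := le_degree_of_mem_occ c hgen hdim hJμ he.1.1
    rwa [Finsupp.degree_eq_sum, Fin.sum_univ_three] at this
  have hs1 := spt₁_chartPt_add he.1.2 hdeg
  have hs2 := spt₂_chartPt μ e
  have hlow' : chartPt μ e ∈ lowPts c' ((J.map φ).colon {φ (c 1) ^ μ}) μ :=
    ⟨hmem, by rw [hs2, hβ]; exact h2⟩
  have hle := slopeOf_le_epsCu hlow'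
  have hslope : slopeOf c' ((J.map φ).colon {φ (c 1) ^ μ}) μ (chartPt μ e) =
      ((d : ℕ) : ℚ) / ((n - d : ℕ) : ℚ) := by
    unfold slopeOf
    rw [hs2, hβ, hd, Nat.cast_sub h2.le, Nat.cast_sub hdn.le, hn, Nat.cast_sub h1.le,
      Nat.cast_sub h2.le]
    congr 1
    have e1 : ((spt₁ μ (chartPt μ e) + μ.factorial : ℕ) : ℚ) = spt₁ μ e + spt₂ μ e := by
      exact_mod_cast hs1
    have e2 : ((alphaS c' ((J.map φ).colon {φ (c 1) ^ μ}) μ + μ.factorial : ℕ) : ℚ) =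
        alphaS c J μ + betaS c J μ := by exact_mod_cast hα'
    push_cast at e1 e2
    linarith
  rw [← hslope]; exact hle

include h₁ h₀ h₂ hgen hdim hgen' hdim' in
/-- **Cutkosky 2009, Lemma 10.14's `ε`-law at the chart origin: "If `β₁ = β`, and `ε ≠ 0`, then
`1/ε₁ = 1/ε − 1`"** (for `Ω` read in the chart parameters). [cite: Cutkosky2009, Lemma 10.14 p. 33 l. 46–58] -/
theorem invEpsCu_colon_point_add_one (hJμ : J ≤ maximalIdeal R ^ μ) (hne : (pts c J μ).Nonempty)
    (hδ : μ.factorial < deltaS c J μ)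
    (hβ : betaS c' ((J.map φ).colon {φ (c 1) ^ μ}) μ = betaS c J μ) (hε : 0 < epsCu c J μ) :
    invEpsCu c' ((J.map φ).colon {φ (c 1) ^ μ}) μ + 1 = invEpsCu c J μ := by
  obtain ⟨e, he, heq⟩ : ∃ e ∈ lowPts c J μ, slopeOf c J μ e = epsCu c J μ := by
    rcases epsCu_eq_zero_or_exists (c := c) (J := J) (μ := μ) with h0 | h
    · rw [h0] at hε; exact absurd hε (lt_irrefl _)
    · exact h
  have hδαβ := deltaS_eq_of_betaS_colon_eq φ h₁ h₀ h₂ hgen hdim hgen' hdim' hJμ hne hδ hβ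
  have hγ : gammaMinusS c J μ = betaS c J μ := by
    rw [← hβ, betaS_colon_eq φ h₁ h₀ h₂ hgen hdim hgen' hdim' hJμ hne hδ]
  have h1 := alphaS_lt_spt₁_of_mem_lowPts he
  have h2 := he.2
  have hdn := drop_lt_run hδαβ hγ he
  -- `ε′ = d/(n − d)` exactly
  have hup : ∀ e' ∈ lowPts c' ((J.map φ).colon {φ (c 1) ^ μ}) μ,
      slopeOf c' ((J.map φ).colon {φ (c 1) ^ μ}) μ e' ≤
        ((betaS c J μ - spt₂ μ e : ℕ) : ℚ) /
          ((spt₁ μ e - alphaS c J μ : ℕ) - (betaS c J μ - spt₂ μ e : ℕ) : ℕ) :=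
    fun e' he' => slopeOf_colon_point_le φ h₁ h₀ h₂ hgen hdim hgen' hdim' hJμ hne hδ hβ he heq he'
  have hlow := le_epsCu_colon_point φ h₁ h₀ h₂ hgen hdim hgen' hdim' hJμ hne hδ hβ he heq
  have hε' : epsCu c' ((J.map φ).colon {φ (c 1) ^ μ}) μ =
      ((betaS c J μ - spt₂ μ e : ℕ) : ℚ) /
        ((spt₁ μ e - alphaS c J μ : ℕ) - (betaS c J μ - spt₂ μ e : ℕ) : ℕ) := by
    refine le_antisymm ?_ hlow
    rcases epsCu_eq_zero_or_exists (c := c') (J := (J.map φ).colon {φ (c 1) ^ μ}) (μ := μ) with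
      h0 | ⟨e', he', heq'⟩
    · rw [h0]; positivity
    · rw [← heq']; exact hup e' he'
  have hεval : epsCu c J μ = ((betaS c J μ - spt₂ μ e : ℕ) : ℚ) / ((spt₁ μ e - alphaS c J μ : ℕ) : ℚ) := by
    rw [← heq]; unfold slopeOf
    rw [Nat.cast_sub h2.le, Nat.cast_sub h1.le]
  have hdQ : (0 : ℚ) < ((betaS c J μ - spt₂ μ e : ℕ) : ℚ) := by exact_mod_cast (show 0 < betaS c J μ - spt₂ μ e by omega)
  have hndQ : (0 : ℚ) < (((spt₁ μ e - alphaS c J μ : ℕ) - (betaS c J μ - spt₂ μ e : ℕ) : ℕ) : ℚ) := by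
    exact_mod_cast (show 0 < (spt₁ μ e - alphaS c J μ) - (betaS c J μ - spt₂ μ e) by omega)
  have hε'ne : epsCu c' ((J.map φ).colon {φ (c 1) ^ μ}) μ ≠ 0 := by
    rw [hε']; exact (div_pos hdQ hndQ).ne'
  unfold invEpsCu
  rw [if_neg hε'ne, if_neg hε.ne', hε', hεval, inv_div, inv_div]
  have hsub : (((spt₁ μ e - alphaS c J μ : ℕ) - (betaS c J μ - spt₂ μ e : ℕ) : ℕ) : ℚ) =
      ((spt₁ μ e - alphaS c J μ : ℕ) : ℚ) - ((betaS c J μ - spt₂ μ e : ℕ) : ℚ) := by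
    rw [Nat.cast_sub hdn.le]
  rw [← WithTop.coe_one, ← WithTop.coe_add, WithTop.coe_eq_coe, hsub, sub_div, div_self hdQ.ne']
  ring

include h₁ h₀ h₂ hgen hdim hgen' hdim' in
/-- If `β′ = β` and `ε = 0` (no Newton point below `β`) then `ε′ = 0` as well.
[cite: Cutkosky2009, Lemma 10.14 proof p. 33 l. 65–68] -/
theorem epsCu_colon_point_eq_zero (hJμ : J ≤ maximalIdeal R ^ μ) (hne : (pts c J μ).Nonempty)
    (hδ : μ.factorial < deltaS c J μ)
    (hβ : betaS c' ((J.map φ).colon {φ (c 1) ^ μ}) μ = betaS c J μ) (h0 : epsCu c J μ = 0) :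
    epsCu c' ((J.map φ).colon {φ (c 1) ^ μ}) μ = 0 := by
  have hβε := betaS_eq_epsS_of_lowPts_eq_empty hne ((epsCu_eq_zero_iff).mp h0)
  have hεeq := epsS_colon_eq φ h₁ h₀ h₂ hgen hdim hgen' hdim' hJμ hne hδ
  rw [epsCu_eq_zero_iff]
  apply Set.eq_empty_of_forall_notMem
  intro e' he'
  have := epsS_le he'.1
  have h2' := he'.2
  omega

include h₁ h₀ h₂ hgen hdim hgen' hdim' in
/-- **`Ω′ < Ω` at the origin of the chart** (Tr1, `η = 0`, chart parameters), provided some Newton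
point lies below the line `b = 1` ("`I ⊄ (y, z)^r`", which holds when `Sing_r(I)` is the closed
point): `β′ < β`, or `β′ = β` and `1/ε′ = 1/ε − 1`, or `β′ = β`, `ε′ = ε = 0` and
`α′ = α + β − 1 < α`. [cite: Cutkosky2009, Lemma 10.14 p. 33 l. 46–68; §10.1 obs. 4 p. 28 l. 63] -/
theorem OmegaCu_colon_point_lt (hJμ : J ≤ maximalIdeal R ^ μ) (hne : (pts c J μ).Nonempty)
    (hδ : μ.factorial < deltaS c J μ) (hyz : ∃ e ∈ pts c J μ, spt₂ μ e < μ.factorial) :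
    OmegaCu c' ((J.map φ).colon {φ (c 1) ^ μ}) μ < OmegaCu c J μ := by
  rw [lt_iff_components]
  simp only [bC_OmegaCu, mC_OmegaCu, aC_OmegaCu]
  rcases (betaS_colon_le φ h₁ h₀ h₂ hgen hdim hgen' hdim' hJμ hne hδ).lt_or_eq with hlt | hβ
  · exact Or.inl hlt
  · refine Or.inr ⟨hβ, ?_⟩
    rcases (epsCu_nonneg c J μ).lt_or_eq with hε | h0
    · -- `1/ε′ + 1 = 1/ε` with finite values
      refine Or.inl ?_
      have hlaw := invEpsCu_colon_point_add_one φ h₁ h₀ h₂ hgen hdim hgen' hdim' hJμ hne hδ hβ hε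
      rcases invEpsCu_top_or_pos (c := c') (J := (J.map φ).colon {φ (c 1) ^ μ}) (μ := μ) with
        htop | ⟨q, hq, hq'⟩
      · exfalso
        rw [htop, top_add] at hlaw
        exact ((invEpsCu_eq_top_iff).not.mpr hε.ne') hlaw.symm
      · rw [hq'] at hlaw ⊢
        rw [← hlaw, ← WithTop.coe_one, ← WithTop.coe_add, WithTop.coe_lt_coe]
        linarith
    · -- `ε = 0 = ε′`: `α′ = α + β − L < α` since `β < L`
      have h0' := epsCu_colon_point_eq_zero φ h₁ h₀ h₂ hgen hdim hgen' hdim' hJμ hne hδ hβ h0.symm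
      refine Or.inr ⟨by rw [(invEpsCu_eq_top_iff).mpr h0', (invEpsCu_eq_top_iff).mpr h0.symm], ?_⟩
      have hα' := alphaS_colon_add_of_betaS_colon_eq φ h₁ h₀ h₂ hgen hdim hgen' hdim' hJμ hne hδ hβ
      obtain ⟨e, he, hlt⟩ := hyz
      have hβε := betaS_eq_epsS_of_lowPts_eq_empty hne ((epsCu_eq_zero_iff).mp h0.symm)
      have := epsS_le he
      omega

include h₁ h₀ h₂ hgen hdim hgen' hdim' in
/-- The step law `CuStep` of Theorem 10.18 holds for the point step at the chart origin.
[cite: Cutkosky2009, Thm. 10.18 p. 36 l. 55–72; Lemma 10.14 p. 33 l. 46–58] -/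
theorem cuStep_colon_point (hJμ : J ≤ maximalIdeal R ^ μ) (hne : (pts c J μ).Nonempty)
    (hδ : μ.factorial < deltaS c J μ) (hyz : ∃ e ∈ pts c J μ, spt₂ μ e < μ.factorial) :
    CuStep (OmegaCu c' ((J.map φ).colon {φ (c 1) ^ μ}) μ) (OmegaCu c J μ) := by
  refine cuStep_OmegaCu (OmegaCu_colon_point_lt φ h₁ h₀ h₂ hgen hdim hgen' hdim' hJμ hne hδ hyz)
    fun hβ _ htop => ?_
  have hε : 0 < epsCu c J μ :=
    (epsCu_nonneg c J μ).lt_of_ne (fun h => htop ((invEpsCu_eq_top_iff).mpr h.symm))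
  exact invEpsCu_colon_point_add_one φ h₁ h₀ h₂ hgen hdim hgen' hdim' hJμ hne hδ hβ hε

end PointChart

end Literature.AlgebraicGeometry.Resolution.Cutkosky2009
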